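import Summits.RiemannHypothesis.RiemannHypothesis.Theses.WeilWindowFlow

/-!
# Route WeilWindowFlow — Assembly

The assembly item of route `WeilWindowFlow` (ledger `stmt-RiemannHypothesis-1045`):

  `Assembly : GronwallLeakage → Summit.RiemannHypothesis`.

The Grönwall leakage law for the window bottom `ε = weilGroundEnergy` (thesis X of the route)
implies the Riemann Hypothesis, using only proved tree facts:

* `Literature.NumberTheory.LFunctions.weilQuadratic_coercive 0` (Bombieri 2000, Thm 12): Weil
  positivity on every window `a ≤ a₀`, hence `ε(a₀) ≥ 0` by
  `weilGroundEnergy_nonneg_iff_holds`;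
* the leakage law transports `ε ≥ 0` from `a₀` to every `a ≥ a₀`
  (`ε(a) ≥ ε(a₀) · exp(−∫ C) ≥ 0`);
* `weilGroundEnergy_nonneg_iff_holds` turns `ε(a) ≥ 0` back into `WeilPositivityOn a`;
* Yoshida's criterion `riemannHypothesis_iff_forall_weilPositivityOn` and
  `Summit.RiemannHypothesis_iff` conclude.

This is exactly the route's kernel-checked deciding theorem `WeilWindowFlow.closes`; we give both
the one-line derivation from `closes` (the closing theorem) and, for robustness of the record, a
self-contained proof from the tree facts (`assembly_direct`).
-/

-- `Summit.RiemannHypothesis.RiemannHypothesis.…` repeats a namespace component by design (D-0017).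
set_option linter.dupNamespace false

namespace Summit.RiemannHypothesis.RiemannHypothesis.Theorems

open Summit.RiemannHypothesis.RiemannHypothesis.Theses

/-- **Assembly of route WeilWindowFlow** (item `stmt-RiemannHypothesis-1045`): the Grönwall
leakage law for the Weil window bottom implies the Riemann Hypothesis. One line from the route's
deciding theorem `WeilWindowFlow.closes`. -/
theorem weilWindowFlow_assembly : WeilWindowFlow.Assembly := by
  unfold WeilWindowFlow.Assembly
  exact fun hX => WeilWindowFlow.closes hX

/-- Self-contained variant of `weilWindowFlow_assembly`, proved directly from the tree facts
(`weilQuadratic_coercive`, `weilGroundEnergy_nonneg_iff_holds`,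
`riemannHypothesis_iff_forall_weilPositivityOn`, `Summit.RiemannHypothesis_iff`) without going
through `WeilWindowFlow.closes`. -/
theorem weilWindowFlow_assembly_direct : WeilWindowFlow.Assembly := by
  unfold WeilWindowFlow.Assembly
  intro hX
  refine (_root_.Summit.RiemannHypothesis_iff).2 ?_
  refine
    (_root_.Literature.NumberTheory.LFunctions.riemannHypothesis_iff_forall_weilPositivityOn).2 ?_
  obtain ⟨a₀, ha₀, hcoer⟩ := _root_.Literature.NumberTheory.LFunctions.weilQuadratic_coercive 0
  have hiff : ∀ {a : ℝ}, 0 < a →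
      (0 ≤ _root_.Literature.NumberTheory.LFunctions.weilGroundEnergy a ↔
        _root_.Literature.NumberTheory.LFunctions.WeilPositivityOn a) :=
    _root_.Literature.NumberTheory.LFunctions.weilGroundEnergy_nonneg_iff_holds
  -- small windows: the coercive anchor with constant 0 is Weil positivity itself
  have hsmall : ∀ a : ℝ, 0 < a → a ≤ a₀ →
      _root_.Literature.NumberTheory.LFunctions.WeilPositivityOn a := by
    intro a ha hle g hg hsupp
    have h := hcoer a ha hle g hg hsupp
    simpa using h
  intro a ha
  by_cases hle : a ≤ a₀
  · exact hsmall a ha hle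
  · -- large windows: transport ε(a₀) ≥ 0 along the leakage law
    have hlt : a₀ ≤ a := le_of_lt (lt_of_not_ge hle)
    have h0 : 0 ≤ _root_.Literature.NumberTheory.LFunctions.weilGroundEnergy a₀ :=
      (hiff ha₀).2 (hsmall a₀ ha₀ le_rfl)
    obtain ⟨C, hC⟩ := hX
    have h1 := (hC a₀ a ha₀ hlt).2
    have h2 : 0 ≤ _root_.Literature.NumberTheory.LFunctions.weilGroundEnergy a :=
      le_trans (mul_nonneg h0 (Real.exp_pos _).le) h1
    exact (hiff ha).1 h2

end Summit.RiemannHypothesis.RiemannHypothesis.Theorems
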